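import Summits.CriticalPhenomena.SAWScalingLimit.Theorems.SAWLeftRightFKGFKGToTraversalBoundWitnessCfg
import Summits.CriticalPhenomena.SAWScalingLimit.Theorems.SAWLeftRightFKGFKGToTraversalBoundWindowReparam
import Summits.CriticalPhenomena.SAWScalingLimit.Theorems.SAWLeftRightFKGFKGToTraversalBoundSlitNecklaceOutline
import HarnessLib

/-!
# Witness glue T2: an outline arc walk without `k` windows yields the far-tip witness
(crux `SAWLeftRightFKG.FKGToTraversalBound`, stmt-CriticalPhenomena-1878; line `slit-necklace`,
registered stub `witness_route` of the planar witness `stub_necklaceWitnessFarU`)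

Setting: a far-tip configuration `cfg : FarTipCfg D` (…WitnessCfg), a finite site set `F` off the attached
set `cfg.K = Sp ∪ Ext` whose lattice-adjacent sites are adjacent in the carrier graph `cfg.G` (FACT A of
`free_carrier`), and the wall-follower tour `btour F e₀` of the outline of `F` with `bsite e₀ = t₀`,
`bsite (btour F e₀ n₁) = t₁` and period `N`.  A lattice walk `p` inside `F` along one of the two arcs
`(0, n₁)` / `(n₁, N)` joins `t₀` to `t₁` (resp. `t₁` to `t₀`).  If `p` has NO `k` strictly separated index
windows across `D(y; σ₁, σ₂)` then `HasFarTipWitness D.carrier δ Sp γ τ τ' k y σ₁ σ₂` holds: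

* reverse `p` in the second case (`hasSepWindows_reverse`), so that WLOG `p : t₀ → t₁`;
* transfer `p` to the domain graph `D_δ` (`Walk.transfer`: every edge joins two `F`-sites, hence is a
  `cfg.G`-edge by FACT A, hence a `D_δ`-edge by the presentation identity `cfg.hid`) — same support, same
  `getVert`;
* loop-erase it (`exists_isPath_strictMono_getVert`) to a path `Q : t₀ → t₁` with a strictly monotone index
  trace; `Q` avoids `Sp` and `Ext` because its vertices are in `F`, and `k` windows of `Q` would push forward
  to `k` windows of `p` (`hasSepWindows_of_strictMono_getVert`).

Pure bookkeeping on Mathlib's `SimpleGraph.Walk` API; no literature fact.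
-/

noncomputable section

open Set SimpleGraph
open Literature.Probability.LatticeModels
open Literature.Probability.RandomPlanarGeometry
open Summit.CriticalPhenomena.SAWScalingLimit.Theorems.FKGToTraversalBound.Negative (dom)

namespace Summit.CriticalPhenomena.SAWScalingLimit.Theorems.FKGToTraversalBound.SlitNecklace

/-! ### Transfer of a walk to another graph containing its edges -/

/-- The edges of a walk all of whose vertices satisfy `P` lie in any graph `H` containing the `G`-edges
between `P`-vertices. [folklore] -/
theorem route_edges_mem_edgeSet {V : Type*} {G H : SimpleGraph V} {u v : V} (p : G.Walk u v)
    (P : V → Prop) (hP : ∀ z ∈ p.support, P z) (hadj : ∀ x y, P x → P y → G.Adj x y → H.Adj x y) :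
    ∀ e, e ∈ p.edges → e ∈ H.edgeSet := by
  induction p with
  | nil => intro e he; simp at he
  | @cons a b c h q ih =>
    intro e he
    rw [Walk.edges_cons, List.mem_cons] at he
    rcases he with rfl | he
    · exact (SimpleGraph.mem_edgeSet H).2 (hadj a b (hP a (Walk.start_mem_support _))
        (hP b (by rw [Walk.support_cons]; exact List.mem_cons_of_mem _ (Walk.start_mem_support _))) h)
    · exact ih (fun z hz => hP z (by rw [Walk.support_cons]; exact List.mem_cons_of_mem _ hz)) e he

/-- A transferred walk has the same vertices, index by index. [folklore] -/
theorem route_getVert_transfer {V : Type*} {G H : SimpleGraph V} {u v : V} (p : G.Walk u v)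
    (hp : ∀ e, e ∈ p.edges → e ∈ H.edgeSet) (n : ℕ) : (p.transfer H hp).getVert n = p.getVert n := by
  rw [Walk.getVert_eq_getD_support, Walk.support_transfer, ← Walk.getVert_eq_getD_support]

/-- No `k` separated windows of `p` means no `k` separated windows of `p.reverse`. [folklore] -/
theorem route_not_hasSepWindows_reverse {V E : Type*} [PseudoMetricSpace E] {G : SimpleGraph V} {u v : V}
    (emb : V → E) (p : G.Walk u v) (k : ℕ) (y : E) (σ₁ σ₂ : ℝ)
    (h : ¬ HasSepWindows emb p k 0 p.length y σ₁ σ₂) :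
    ¬ HasSepWindows emb p.reverse k 0 p.reverse.length y σ₁ σ₂ := by
  intro hW
  have h' := hasSepWindows_reverse emb p.reverse k y σ₁ σ₂ hW
  rw [Walk.reverse_reverse] at h'
  exact h h'

/-! ### The core: a lattice walk `t₀ → t₁` inside `F` without `k` windows gives the witness -/

/-- **Core of the route reduction.**  A lattice walk from `t₀` to `t₁` inside a set `F` off `K` with FACT A and
without `k` strictly separated index windows across `D(y; σ₁, σ₂)` yields the far-tip witness with budget `k`:
transfer to `D_δ`, loop-erase, and push windows forward along the strictly monotone trace. [folklore] -/
theorem route_core {D : DobrushinDomain} (cfg : FarTipCfg D) (F : Finset (Site 2)) (k : ℕ) (y : ℂ)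
    (σ₁ σ₂ : ℝ) {u v : Site 2} (w : (zdGraph 2).Walk u v) (hu : u = cfg.t₀) (hv : v = cfg.t₁)
    (hFK : ∀ x ∈ F, x ∉ cfg.K) (hA : ∀ x ∈ F, ∀ x' ∈ F, (zdGraph 2).Adj x x' → cfg.G.Adj x x')
    (hsupp : ∀ z ∈ w.support, z ∈ F) (hW : ¬ HasSepWindows (meshPoint cfg.δ) w k 0 w.length y σ₁ σ₂) :
    HasFarTipWitness D.carrier cfg.δ (↑cfg.Sp) cfg.γ cfg.τ cfg.τ' k y σ₁ σ₂ := by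
  subst hu hv
  -- (1) transfer to the domain graph `D_δ`
  have hedges : ∀ e, e ∈ w.edges → e ∈ cfg.Dg.edgeSet :=
    route_edges_mem_edgeSet w (fun z => z ∈ F) hsupp fun x x' hx hx' hxx' =>
      ((cfg.hid x x').1 (hA x hx x' hx' hxx')).1
  set w' : cfg.Dg.Walk cfg.t₀ cfg.t₁ := w.transfer cfg.Dg hedges with hw'
  have hlen' : w'.length = w.length := Walk.length_transfer w hedges
  have hsupp' : ∀ z ∈ w'.support, z ∈ F := fun z hz => by
    rw [hw', Walk.support_transfer] at hz
    exact hsupp z hz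
  have hget' : ∀ n, w'.getVert n = w.getVert n := fun n => route_getVert_transfer w hedges n
  -- (2) loop erasure with a strictly monotone trace
  obtain ⟨Q, ψ, hQ, hψ, hψlen, hsub, hget⟩ := exists_isPath_strictMono_getVert w'
  -- (3)–(5) the witness
  refine ⟨cfg.hττ'.le, cfg.idx_facts.2.2.1.le.trans cfg.idx_facts.2.2.2, Q, hQ, fun z hz => ?_, fun hWQ => ?_⟩
  · -- avoidance: the vertices of `Q` are in `F`, hence off `K = Sp ∪ Ext`
    have hzK : z ∉ cfg.K := hFK z (hsupp' z (hsub z hz))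
    rw [FarTipCfg.K_def, Finset.mem_union, not_or] at hzK
    refine ⟨fun h => hzK.1 (Finset.mem_coe.1 h), fun m hm hm' hzm => hzK.2 ?_⟩
    exact (FarTipCfg.mem_Ext_iff cfg).2 ⟨m, hm, hm', hzm.symm⟩
  · -- windows push forward along `ψ` to windows of `w`
    refine hW (hasSepWindows_of_strictMono_getVert (meshPoint cfg.δ) (meshPoint cfg.δ) w Q ψ k y σ₁ σ₂ hψ
      (hψlen.trans hlen').le (fun n hn => ?_) hWQ)
    rw [hget n hn, hget']

/-! ### The registered stub -/

/-- **Registered glue T2 (route reduction).**  For a far-tip configuration `cfg`, a site set `F` off `K` with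
FACT A, and the wall-follower tour of the outline of `F` from `e₀` (`bsite e₀ = t₀`) through position `n₁`
(`bsite = t₁`) with period `N`: a lattice walk `p` inside `F` along one of the two arcs `(0, n₁)`, `(n₁, N)`
without `k` strictly separated index windows across `D(y; σ₁, σ₂)` yields
`HasFarTipWitness D.carrier δ Sp γ τ τ' k y σ₁ σ₂` (reverse the walk on the second arc, transfer it to `D_δ`,
loop-erase, push windows forward). [folklore] -/
theorem witness_route : ∀ {D : DobrushinDomain} (cfg : FarTipCfg D) (F : Finset (Site 2)) (e₀ : Site 2 × ODir) (n₁ N m n k : ℕ) (y : ℂ) (σ₁ σ₂ : ℝ) (p : (zdGraph 2).Walk (bsite (btour (↑F : Set (Site 2)) e₀ m)) (bsite (btour (↑F : Set (Site 2)) e₀ n))), (∀ x ∈ F, x ∉ cfg.K) → (∀ x ∈ F, ∀ x' ∈ F, (zdGraph 2).Adj x x' → cfg.G.Adj x x') → bsite e₀ = cfg.t₀ → bsite (btour (↑F : Set (Site 2)) e₀ n₁) = cfg.t₁ → btour (↑F : Set (Site 2)) e₀ N = e₀ → ((m = 0 ∧ n = n₁) ∨ (m = n₁ ∧ n = N)) →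 (∀ z ∈ p.support, z ∈ F) → ¬ HasSepWindows (meshPoint cfg.δ) p k 0 p.length y σ₁ σ₂ → HasFarTipWitness D.carrier cfg.δ (↑cfg.Sp) cfg.γ cfg.τ cfg.τ' k y σ₁ σ₂ := by
  intro D cfg F e₀ n₁ N m n k y σ₁ σ₂ p hFK hA h₀ h₁ hN hmn hsupp hW
  rcases hmn with ⟨rfl, rfl⟩ | ⟨rfl, rfl⟩
  · -- first arc: `p : t₀ → t₁`
    refine route_core cfg F k y σ₁ σ₂ p ?_ h₁ hFK hA hsupp hW
    rw [btour_zero, h₀]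
  · -- second arc: `p : t₁ → t₀`; reverse it
    refine route_core cfg F k y σ₁ σ₂ p.reverse ?_ h₁ hFK hA (fun z hz => ?_)
      (route_not_hasSepWindows_reverse (meshPoint cfg.δ) p k y σ₁ σ₂ hW)
    · rw [hN, h₀]
    · rw [Walk.support_reverse, List.mem_reverse] at hz
      exact hsupp z hz

end Summit.CriticalPhenomena.SAWScalingLimit.Theorems.FKGToTraversalBound.SlitNecklace

end
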